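import Summits.Ventures.PercRepro.S1JointPerFlat2
import Summits.Ventures.PercRepro.RankLevelSetDepCountSplit

/-!
# PercRepro — S1 JOINT PAIR BUDGET, THE SPLIT COUNT, PAIRS AVOIDING THEIR CIRCUIT (p2, gen 15; SUBCLAIM-S1 §4,
LEMMAS J and J′)

`S1JointSplit.ncard_eRk_eq_ncard_le_le_split_joint` with the pairs counted as in `S1JointPerFlat2`: a pair `(C, B')`
of `P` has `B'` disjoint from `C`, so `B' ⊆ E ∖ C` and the pairs with a `k`-circuit number at most
`s_k·C(n − k, q + 1 − k)`; a pair of `Pbig` has `C ⊆ S₀` and `B' ⊆ S₀ ∖ C`, at most `s_k·C(m − k, q + 1 − k)` with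
`m = min((q + 1)d, n)`. The proof is night-1's with `hPcard` / `hPbigcard` refined and the joint assembly.

* **`ncard_eRk_eq_ncard_le_le_split_joint'`** — `#{B ⊆ E : r(B) = q, |B| ≤ d} ≤ C(n, q) + σ_small·Σ_k s_k·C(n − k, q+1−k)
  + (σ − σ_small)·Σ_k s_k·C(min((q+1)d, n) − k, q+1−k)`.
Axioms: standard.
-/

open scoped Matroid

namespace PercRepro

namespace S1

open Set

variable {α : Type} {M : Matroid α}

/-- **THE RANK-`q` SETS OF AT MOST `d` ELEMENTS, FIBRES SPLIT BY THE CLOSURE SIZE, PAIRS CHARGED ONCE.** With every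
circuit of `≥ 3` elements, every set of rank `≤ q` of `≤ f` points, every set of rank `≤ q − 1` of `≤ f'` points, and
`|E| = r(M) + d`: `#{B ⊆ E : r(B) = q, |B| ≤ d} ≤ C(n, q) + σ_small·Σ_k s_k·C(n, q+1−k) +
(σ − σ_small)·Σ_k s_k·C(min((q+1)d, n), q+1−k)` with `σ_small = Σ_{j ≤ d−q−1} C(f' − q, j)`,
`σ = Σ_{j ≤ d−q−1} C(f − q − 1, j)`, `s_k` the number of `k`-element circuits. -/
theorem ncard_eRk_eq_ncard_le_le_split_joint' (M : Matroid α) [M.Finite] (q f f' : ℕ) (hq : 1 ≤ q)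
    (hcirc : ∀ C, M.IsCircuit C → 3 ≤ C.encard)
    (hflat : ∀ X ⊆ M.E, M.eRk X ≤ q → X.ncard ≤ f)
    (hflat' : ∀ X ⊆ M.E, M.eRk X ≤ (q - 1 : ℕ) → X.ncard ≤ f') {d : ℕ} (hd : M.E.encard = M.eRank + d) :
    {B : Set α | B ⊆ M.E ∧ M.eRk B = q ∧ B.ncard ≤ d}.ncard ≤
      M.E.ncard.choose q +
        (∑ j ∈ Finset.range (d - (q + 1) + 1), Nat.choose (f' - q) j) *
          (∑ k ∈ Finset.Icc 3 (q + 1),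
            {C | M.IsCircuit C ∧ C.ncard = k}.ncard * (M.E.ncard - k).choose (q + 1 - k)) +
        ((∑ j ∈ Finset.range (d - (q + 1) + 1), Nat.choose (f - (q + 1)) j) -
          (∑ j ∈ Finset.range (d - (q + 1) + 1), Nat.choose (f' - q) j)) *
          (∑ k ∈ Finset.Icc 3 (q + 1),
            {C | M.IsCircuit C ∧ C.ncard = k}.ncard * (min ((q + 1) * d) M.E.ncard - k).choose (q + 1 - k)) := by
  classical
  set Ef := M.ground_finite.toFinset with hEf
  have hE : (Ef : Set α) = M.E := Set.Finite.coe_toFinset _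
  have hEcard : Ef.card = M.E.ncard := (Set.ncard_eq_toFinset_card _ M.ground_finite).symm
  set σs := ∑ j ∈ Finset.range (d - (q + 1) + 1), Nat.choose (f' - q) j with hσs
  set σ := ∑ j ∈ Finset.range (d - (q + 1) + 1), Nat.choose (f - (q + 1)) j with hσ
  -- the union of the short circuits
  set S₀ := ⋃₀ Matroid.circuitsLE M (q + 1) with hS₀
  have hS₀E : S₀ ⊆ M.E := by
    intro x hx
    obtain ⟨C, hC, hxC⟩ := mem_sUnion.1 hx
    exact Matroid.subset_ground_of_mem_circuitsLE hC hxC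
  have hS₀fin : S₀.Finite := M.ground_finite.subset hS₀E
  set Sf := hS₀fin.toFinset with hSf
  have hScoe : (Sf : Set α) = S₀ := Set.Finite.coe_toFinset _
  have hScard : Sf.card ≤ min ((q + 1) * d) M.E.ncard := by
    refine le_min ?_ ?_
    · have h := Matroid.encard_sUnion_circuitsLE_le (M := M) (k := q + 1) (d := d) hd
      rw [← hS₀fin.cast_ncard_eq, Set.ncard_eq_toFinset_card _ hS₀fin] at h
      exact_mod_cast h
    · rw [← Set.ncard_eq_toFinset_card _ hS₀fin]
      exact Set.ncard_le_ncard hS₀E M.ground_finite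
  set S := {B : Set α | B ⊆ M.E ∧ M.eRk B = q ∧ B.ncard ≤ d} with hS
  set S₁ := {B : Set α | B ⊆ (Ef : Set α) ∧ B.ncard = q} with hS₁
  set S₂ := {B : Set α | B ⊆ M.E ∧ M.eRk B = q ∧ q < B.ncard ∧ B.ncard ≤ d} with hS₂
  have hsplit : S ⊆ S₁ ∪ S₂ := by
    intro B hB
    have hBfin : B.Finite := M.ground_finite.subset hB.1
    have hle : q ≤ B.ncard := by
      have := M.eRk_le_encard B
      rw [hB.2.1, ← hBfin.cast_ncard_eq] at this
      exact_mod_cast this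
    rcases hle.lt_or_eq with h | h
    · exact Or.inr ⟨hB.1, hB.2.1, h, hB.2.2⟩
    · exact Or.inl ⟨by rw [hE]; exact hB.1, h.symm⟩
  have hS₁fin : S₁.Finite := (Ef.finite_toSet.finite_subsets).subset (fun B hB => hB.1)
  have hS₂fin : S₂.Finite := M.ground_finite.finite_subsets.subset (fun B hB => hB.1)
  have hS₁ : S₁.ncard = M.E.ncard.choose q := by
    rw [hS₁, PercRepro.ncard_subsets_ncard_eq Ef q, hEcard]
  -- the circuits of each size, the subsets of `E` and of `S₀` of each size
  have hcircfin : ∀ k : ℕ, {C | M.IsCircuit C ∧ C.ncard = k}.Finite := fun k =>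
    M.ground_finite.finite_subsets.subset (fun C hC => hC.1.subset_ground)
  set 𝒞 : ℕ → Finset (Set α) := fun k => (hcircfin k).toFinset with h𝒞
  set 𝓑 : ℕ → Finset (Set α) := fun j => (Ef.powersetCard j).image (fun s : Finset α => (s : Set α)) with h𝓑
  set 𝓑S : ℕ → Finset (Set α) := fun j => (Sf.powersetCard j).image (fun s : Finset α => (s : Set α)) with h𝓑S
  set 𝒞S : ℕ → Finset (Set α) := fun k => (𝒞 k).filter (fun C => C ⊆ S₀) with h𝒞S
  set 𝓑C : Set α → ℕ → Finset (Set α) := fun C j =>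
    ((M.ground_finite.sdiff (t := C)).toFinset.powersetCard j).image (fun s : Finset α => (s : Set α)) with h𝓑C
  set 𝓑SC : Set α → ℕ → Finset (Set α) := fun C j =>
    ((hS₀fin.sdiff (t := C)).toFinset.powersetCard j).image (fun s : Finset α => (s : Set α)) with h𝓑SC
  have h𝓑card : ∀ j, (𝓑 j).card ≤ M.E.ncard.choose j := by
    intro j
    calc (𝓑 j).card ≤ (Ef.powersetCard j).card := Finset.card_image_le
      _ = Ef.card.choose j := Finset.card_powersetCard j Ef
      _ = M.E.ncard.choose j := by rw [hEcard]
  have h𝓑Scard : ∀ j, (𝓑S j).card ≤ (min ((q + 1) * d) M.E.ncard).choose j := by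
    intro j
    calc (𝓑S j).card ≤ (Sf.powersetCard j).card := Finset.card_image_le
      _ = Sf.card.choose j := Finset.card_powersetCard j Sf
      _ ≤ (min ((q + 1) * d) M.E.ncard).choose j := Nat.choose_le_choose j hScard
  have h𝒞card : ∀ k, (𝒞 k).card = {C | M.IsCircuit C ∧ C.ncard = k}.ncard := fun k =>
    (Set.ncard_eq_toFinset_card _ (hcircfin k)).symm
  have h𝒞Scard : ∀ k, (𝒞S k).card ≤ {C | M.IsCircuit C ∧ C.ncard = k}.ncard := fun k => by
    rw [← h𝒞card k]; exact Finset.card_filter_le _ _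
  have h𝓑Ccard : ∀ k, ∀ C ∈ 𝒞 k, (𝓑C C (q + 1 - k)).card = (M.E.ncard - k).choose (q + 1 - k) := by
    intro k C hC
    rw [h𝒞, Set.Finite.mem_toFinset] at hC
    rw [h𝓑C]
    simp only
    rw [card_image_powersetCard (M.ground_finite.sdiff (t := C)) (q + 1 - k),
      Set.ncard_sdiff' hC.1.subset_ground M.ground_finite, hC.2]
  have h𝓑SCcard : ∀ k, ∀ C ∈ 𝒞S k,
      (𝓑SC C (q + 1 - k)).card ≤ (min ((q + 1) * d) M.E.ncard - k).choose (q + 1 - k) := by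
    intro k C hC
    rw [h𝒞S, Finset.mem_filter, h𝒞, Set.Finite.mem_toFinset] at hC
    rw [h𝓑SC]
    simp only
    rw [card_image_powersetCard (hS₀fin.sdiff (t := C)) (q + 1 - k), Set.ncard_sdiff' hC.2 hS₀fin, hC.1.2]
    have hScard' : S₀.ncard ≤ min ((q + 1) * d) M.E.ncard := by
      rw [Set.ncard_eq_toFinset_card _ hS₀fin]; exact hScard
    exact Nat.choose_le_choose _ (by omega)
  have hmem𝓑 : ∀ (j : ℕ) (B' : Set α), B' ⊆ M.E → B'.ncard = j → B' ∈ 𝓑 j := by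
    intro j B' hB'E hB'
    have hB'fin : B'.Finite := M.ground_finite.subset hB'E
    rw [h𝓑, Finset.mem_image]
    refine ⟨hB'fin.toFinset, ?_, by simp⟩
    rw [Finset.mem_powersetCard]
    refine ⟨?_, by rw [← Set.ncard_eq_toFinset_card B' hB'fin]; exact hB'⟩
    intro x hx
    rw [Set.Finite.mem_toFinset] at hx
    rw [hEf, Set.Finite.mem_toFinset]
    exact hB'E hx
  have hmem𝓑S : ∀ (j : ℕ) (B' : Set α), B' ⊆ S₀ → B'.ncard = j → B' ∈ 𝓑S j := by
    intro j B' hB'S hB'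
    have hB'fin : B'.Finite := hS₀fin.subset hB'S
    rw [h𝓑S, Finset.mem_image]
    refine ⟨hB'fin.toFinset, ?_, by simp⟩
    rw [Finset.mem_powersetCard]
    refine ⟨?_, by rw [← Set.ncard_eq_toFinset_card B' hB'fin]; exact hB'⟩
    intro x hx
    rw [Set.Finite.mem_toFinset] at hx
    rw [hSf, Set.Finite.mem_toFinset]
    exact hB'S hx
  -- the pairs
  set P : Finset (Set α × Set α) :=
    ((Finset.Icc 3 (q + 1)).biUnion (fun k => 𝒞 k ×ˢ 𝓑 (q + 1 - k))).filter
      (fun p => Disjoint p.2 p.1 ∧ M.eRk (p.1 ∪ p.2) ≤ q) with hP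
  set Psmall := P.filter (fun p => (M.closure (p.1 ∪ p.2)).ncard ≤ f' + 1) with hPsmall
  set Pbig := P.filter (fun p => ¬ (M.closure (p.1 ∪ p.2)).ncard ≤ f' + 1) with hPbig
  have hFibfin : ∀ p : Set α × Set α,
      {B : Set α | p.1 ∪ p.2 ⊆ B ∧ B ⊆ M.closure (p.1 ∪ p.2) ∧ B.ncard ≤ d}.Finite := fun p =>
    M.ground_finite.finite_subsets.subset (fun B hB => hB.2.1.trans (M.closure_subset_ground _))
  set Tf : Finset (Set α) := P.biUnion (fun p => (hFibfin p).toFinset) with hTf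
  -- every `B ∈ S₂` lies in some fibre
  have hex : ∀ B ∈ S₂, ∃ p ∈ P, B ∈ (hFibfin p).toFinset := by
    intro B hB
    obtain ⟨C, B', hC, hCB, hB'B, hdisj, hcard, hBcl⟩ :=
      Matroid.exists_circuit_extension_exact hB.1 hB.2.1 hB.2.2.1
    have hCfin : C.Finite := M.ground_finite.subset hC.subset_ground
    have hC3 : 3 ≤ C.ncard := by
      have := hcirc C hC
      rw [← hCfin.cast_ncard_eq] at this
      exact_mod_cast this
    have hCmem : C ∈ 𝒞 C.ncard := by
      rw [h𝒞, Set.Finite.mem_toFinset]; exact ⟨hC, rfl⟩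
    have hB'mem : B' ∈ 𝓑 (q + 1 - C.ncard) := hmem𝓑 _ B' (hB'B.trans hB.1) (by omega)
    have hrk : M.eRk (C ∪ B') ≤ q := by
      rw [← hB.2.1]; exact M.eRk_mono (union_subset hCB hB'B)
    refine ⟨(C, B'), ?_, ?_⟩
    · rw [hP, Finset.mem_filter]
      refine ⟨?_, hdisj, hrk⟩
      rw [Finset.mem_biUnion]
      refine ⟨C.ncard, ?_, ?_⟩
      · rw [Finset.mem_Icc]; omega
      · rw [Finset.mem_product]; exact ⟨hCmem, hB'mem⟩
    · rw [Set.Finite.mem_toFinset]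
      exact ⟨union_subset hCB hB'B, hBcl, hB.2.2.2⟩
  have hS₂sub : S₂ ⊆ (Tf : Set (Set α)) := by
    intro B hB
    obtain ⟨p, hp, hBp⟩ := hex B hB
    rw [Finset.mem_coe, hTf, Finset.mem_biUnion]
    exact ⟨p, hp, hBp⟩
  -- the data of a pair
  have hpair : ∀ p ∈ P, p.1 ⊆ M.E ∧ p.2 ⊆ M.E ∧ (p.1 ∪ p.2).ncard = q + 1 ∧ M.eRk (p.1 ∪ p.2) ≤ q ∧
      ∃ k, k ∈ Finset.Icc 3 (q + 1) ∧ p.1 ∈ 𝒞 k ∧ p.2.ncard = q + 1 - k := by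
    intro p hp
    rw [hP, Finset.mem_filter] at hp
    obtain ⟨hpmem, hdisj, hrk⟩ := hp
    rw [Finset.mem_biUnion] at hpmem
    obtain ⟨k, hk, hpk⟩ := hpmem
    rw [Finset.mem_product] at hpk
    obtain ⟨h1, h2⟩ := hpk
    have h1' := h1
    rw [h𝒞, Set.Finite.mem_toFinset] at h1'
    rw [h𝓑, Finset.mem_image] at h2
    obtain ⟨s, hs, hs'⟩ := h2
    rw [Finset.mem_powersetCard] at hs
    have hp1E : p.1 ⊆ M.E := h1'.1.subset_ground
    have hp2E : p.2 ⊆ M.E := by rw [← hs', ← hE]; exact Finset.coe_subset.2 hs.1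
    have hp1fin : p.1.Finite := M.ground_finite.subset hp1E
    have hp2fin : p.2.Finite := M.ground_finite.subset hp2E
    have hp1c : p.1.ncard = k := h1'.2
    have hp2c : p.2.ncard = q + 1 - k := by rw [← hs', Set.ncard_coe_finset]; exact hs.2
    rw [Finset.mem_Icc] at hk
    refine ⟨hp1E, hp2E, ?_, hrk, k, Finset.mem_Icc.2 hk, h1, hp2c⟩
    rw [ncard_union_eq hdisj.symm hp1fin hp2fin, hp1c, hp2c]
    omega
  -- the fibre bounds: small closures
  have hfib_small : ∀ p ∈ Psmall, ((hFibfin p).toFinset).card ≤ σs := by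
    intro p hp
    rw [hPsmall, Finset.mem_filter] at hp
    obtain ⟨hpP, hsmall⟩ := hp
    obtain ⟨hp1E, hp2E, hU, hrk, -⟩ := hpair p hpP
    have hUE : p.1 ∪ p.2 ⊆ M.E := union_subset hp1E hp2E
    have hFfin : (M.closure (p.1 ∪ p.2)).Finite :=
      M.ground_finite.subset (M.closure_subset_ground _)
    have hUF : p.1 ∪ p.2 ⊆ M.closure (p.1 ∪ p.2) := M.subset_closure _ hUE
    have hFU : (M.closure (p.1 ∪ p.2) \ (p.1 ∪ p.2)).ncard ≤ f' - q := by
      rw [ncard_sdiff hUF (hFfin.subset hUF), hU]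
      omega
    rw [← Set.ncard_eq_toFinset_card _ (hFibfin p)]
    exact Matroid.ncard_fibre_le' hFfin hU hFU d
  -- big closures
  have hfib_big : ∀ p ∈ Pbig, ((hFibfin p).toFinset).card ≤ σ := by
    intro p hp
    rw [hPbig, Finset.mem_filter] at hp
    obtain ⟨hpP, -⟩ := hp
    obtain ⟨hp1E, hp2E, hU, hrk, -⟩ := hpair p hpP
    have hUE : p.1 ∪ p.2 ⊆ M.E := union_subset hp1E hp2E
    have hFfin : (M.closure (p.1 ∪ p.2)).Finite :=
      M.ground_finite.subset (M.closure_subset_ground _)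
    have hFf : (M.closure (p.1 ∪ p.2)).ncard ≤ f :=
      hflat _ (M.closure_subset_ground _) (by rw [M.eRk_closure_eq]; exact hrk)
    have hUF : p.1 ∪ p.2 ⊆ M.closure (p.1 ∪ p.2) := M.subset_closure _ hUE
    have hFU : (M.closure (p.1 ∪ p.2) \ (p.1 ∪ p.2)).ncard ≤ f - (q + 1) := by
      rw [ncard_sdiff hUF (hFfin.subset hUF), hU]
      omega
    rw [← Set.ncard_eq_toFinset_card _ (hFibfin p)]
    exact Matroid.ncard_fibre_le' hFfin hU hFU d
  -- the big pairs live inside `S₀`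
  have hPbig_sub : Pbig ⊆ (Finset.Icc 3 (q + 1)).biUnion (fun k => 𝒞 k ×ˢ 𝓑S (q + 1 - k)) := by
    intro p hp
    rw [hPbig, Finset.mem_filter] at hp
    obtain ⟨hpP, hbig⟩ := hp
    push Not at hbig
    obtain ⟨hp1E, hp2E, hU, hrk, k, hk, h1, hp2c⟩ := hpair p hpP
    have hUE : p.1 ∪ p.2 ⊆ M.E := union_subset hp1E hp2E
    have hsub : M.closure (p.1 ∪ p.2) ⊆ S₀ :=
      Matroid.big_flat_subset_sUnion_circuitsLE hq hflat' hrk hbig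
    have hUF : p.1 ∪ p.2 ⊆ M.closure (p.1 ∪ p.2) := M.subset_closure _ hUE
    rw [Finset.mem_biUnion]
    refine ⟨k, hk, ?_⟩
    rw [Finset.mem_product]
    refine ⟨h1, hmem𝓑S _ p.2 ((subset_union_right.trans hUF).trans hsub) hp2c⟩
  -- the number of pairs: every pair avoids its circuit
  have hP_sub : P ⊆ (Finset.Icc 3 (q + 1)).biUnion
      (fun k => (𝒞 k).biUnion (fun C => ({C} : Finset (Set α)) ×ˢ 𝓑C C (q + 1 - k))) := by
    intro p hp
    have hp' := hp
    rw [hP, Finset.mem_filter] at hp'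
    obtain ⟨-, hdisj, -⟩ := hp'
    obtain ⟨hp1E, hp2E, hU, hrk, k, hk, h1, hp2c⟩ := hpair p hp
    rw [Finset.mem_biUnion]
    refine ⟨k, hk, ?_⟩
    rw [Finset.mem_biUnion]
    refine ⟨p.1, h1, ?_⟩
    rw [Finset.mem_product, Finset.mem_singleton]
    refine ⟨rfl, (mem_image_powersetCard_iff (M.ground_finite.sdiff (t := p.1)) _ p.2).2 ⟨?_, hp2c⟩⟩
    exact Set.subset_sdiff.2 ⟨hp2E, hdisj⟩
  have hPcard : P.card ≤
      ∑ k ∈ Finset.Icc 3 (q + 1), {C | M.IsCircuit C ∧ C.ncard = k}.ncard * (M.E.ncard - k).choose (q + 1 - k) := by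
    calc P.card ≤ ((Finset.Icc 3 (q + 1)).biUnion
          (fun k => (𝒞 k).biUnion (fun C => ({C} : Finset (Set α)) ×ˢ 𝓑C C (q + 1 - k)))).card :=
          Finset.card_le_card hP_sub
      _ ≤ ∑ k ∈ Finset.Icc 3 (q + 1), ((𝒞 k).biUnion (fun C => ({C} : Finset (Set α)) ×ˢ 𝓑C C (q + 1 - k))).card :=
          Finset.card_biUnion_le
      _ ≤ ∑ k ∈ Finset.Icc 3 (q + 1), ∑ C ∈ 𝒞 k, (({C} : Finset (Set α)) ×ˢ 𝓑C C (q + 1 - k)).card :=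
          Finset.sum_le_sum (fun k _ => Finset.card_biUnion_le)
      _ = ∑ k ∈ Finset.Icc 3 (q + 1), {C | M.IsCircuit C ∧ C.ncard = k}.ncard * (M.E.ncard - k).choose (q + 1 - k) := by
          apply Finset.sum_congr rfl
          intro k _
          rw [← h𝒞card k, Finset.card_eq_sum_ones (𝒞 k), Finset.sum_mul]
          apply Finset.sum_congr rfl
          intro C hC
          rw [Finset.card_product, Finset.card_singleton, h𝓑Ccard k C hC, one_mul]
  have hPbig_sub' : Pbig ⊆ (Finset.Icc 3 (q + 1)).biUnion
      (fun k => (𝒞S k).biUnion (fun C => ({C} : Finset (Set α)) ×ˢ 𝓑SC C (q + 1 - k))) := by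
    intro p hp
    rw [hPbig, Finset.mem_filter] at hp
    obtain ⟨hpP, hbig⟩ := hp
    push Not at hbig
    have hpP' := hpP
    rw [hP, Finset.mem_filter] at hpP'
    obtain ⟨-, hdisj, -⟩ := hpP'
    obtain ⟨hp1E, hp2E, hU, hrk, k, hk, h1, hp2c⟩ := hpair p hpP
    have hUE : p.1 ∪ p.2 ⊆ M.E := union_subset hp1E hp2E
    have hsub : M.closure (p.1 ∪ p.2) ⊆ S₀ :=
      Matroid.big_flat_subset_sUnion_circuitsLE hq hflat' hrk hbig
    have hUF : p.1 ∪ p.2 ⊆ M.closure (p.1 ∪ p.2) := M.subset_closure _ hUE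
    rw [Finset.mem_biUnion]
    refine ⟨k, hk, ?_⟩
    rw [Finset.mem_biUnion]
    refine ⟨p.1, ?_, ?_⟩
    · rw [h𝒞S, Finset.mem_filter]
      exact ⟨h1, (subset_union_left.trans hUF).trans hsub⟩
    · rw [Finset.mem_product, Finset.mem_singleton]
      refine ⟨rfl, (mem_image_powersetCard_iff (hS₀fin.sdiff (t := p.1)) _ p.2).2 ⟨?_, hp2c⟩⟩
      exact Set.subset_sdiff.2 ⟨(subset_union_right.trans hUF).trans hsub, hdisj⟩
  have hPbigcard : Pbig.card ≤
      ∑ k ∈ Finset.Icc 3 (q + 1),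
        {C | M.IsCircuit C ∧ C.ncard = k}.ncard * (min ((q + 1) * d) M.E.ncard - k).choose (q + 1 - k) := by
    calc Pbig.card ≤ ((Finset.Icc 3 (q + 1)).biUnion
          (fun k => (𝒞S k).biUnion (fun C => ({C} : Finset (Set α)) ×ˢ 𝓑SC C (q + 1 - k)))).card :=
          Finset.card_le_card hPbig_sub'
      _ ≤ ∑ k ∈ Finset.Icc 3 (q + 1), ((𝒞S k).biUnion (fun C => ({C} : Finset (Set α)) ×ˢ 𝓑SC C (q + 1 - k))).card :=
          Finset.card_biUnion_le
      _ ≤ ∑ k ∈ Finset.Icc 3 (q + 1), ∑ C ∈ 𝒞S k, (({C} : Finset (Set α)) ×ˢ 𝓑SC C (q + 1 - k)).card :=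
          Finset.sum_le_sum (fun k _ => Finset.card_biUnion_le)
      _ ≤ ∑ k ∈ Finset.Icc 3 (q + 1), ∑ _C ∈ 𝒞S k, (min ((q + 1) * d) M.E.ncard - k).choose (q + 1 - k) := by
          apply Finset.sum_le_sum
          intro k _
          apply Finset.sum_le_sum
          intro C hC
          rw [Finset.card_product, Finset.card_singleton, one_mul]
          exact h𝓑SCcard k C hC
      _ ≤ ∑ k ∈ Finset.Icc 3 (q + 1),
          {C | M.IsCircuit C ∧ C.ncard = k}.ncard * (min ((q + 1) * d) M.E.ncard - k).choose (q + 1 - k) := by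
          apply Finset.sum_le_sum
          intro k _
          rw [Finset.sum_const, smul_eq_mul]
          exact Nat.mul_le_mul_right _ (h𝒞Scard k)
  -- the joint budget: `#Psmall + #Pbig = #P`
  have hPsum : Psmall.card + Pbig.card = P.card := by
    rw [hPsmall, hPbig]
    exact Finset.card_filter_add_card_filter_not _
  have hAX : Psmall.card + Pbig.card ≤
      ∑ k ∈ Finset.Icc 3 (q + 1), {C | M.IsCircuit C ∧ C.ncard = k}.ncard * (M.E.ncard - k).choose (q + 1 - k) := by
    rw [hPsum]; exact hPcard
  have hjoint := joint_arith (RS := σs) (RB := σ) hAX hPbigcard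
  -- assemble: `Σ_{p ∈ P} #Fib p = Σ_{small} + Σ_{big}`
  have hTfcard : Tf.card ≤ σs * (∑ k ∈ Finset.Icc 3 (q + 1),
      {C | M.IsCircuit C ∧ C.ncard = k}.ncard * (M.E.ncard - k).choose (q + 1 - k)) +
      (σ - σs) * (∑ k ∈ Finset.Icc 3 (q + 1),
      {C | M.IsCircuit C ∧ C.ncard = k}.ncard * (min ((q + 1) * d) M.E.ncard - k).choose (q + 1 - k)) := by
    have hsum : ∑ p ∈ P, ((hFibfin p).toFinset).card =
        ∑ p ∈ Psmall, ((hFibfin p).toFinset).card + ∑ p ∈ Pbig, ((hFibfin p).toFinset).card := by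
      rw [hPsmall, hPbig]
      exact (Finset.sum_filter_add_sum_filter_not P _ _).symm
    calc Tf.card ≤ ∑ p ∈ P, ((hFibfin p).toFinset).card := Finset.card_biUnion_le
      _ = ∑ p ∈ Psmall, ((hFibfin p).toFinset).card + ∑ p ∈ Pbig, ((hFibfin p).toFinset).card := hsum
      _ ≤ ∑ _p ∈ Psmall, σs + ∑ _p ∈ Pbig, σ :=
          add_le_add (Finset.sum_le_sum hfib_small) (Finset.sum_le_sum hfib_big)
      _ = σs * Psmall.card + σ * Pbig.card := by
          rw [Finset.sum_const, smul_eq_mul, Finset.sum_const, smul_eq_mul, mul_comm Psmall.card,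
            mul_comm Pbig.card]
      _ ≤ _ := hjoint
  calc S.ncard ≤ (S₁ ∪ S₂).ncard := ncard_le_ncard hsplit (hS₁fin.union hS₂fin)
    _ ≤ S₁.ncard + S₂.ncard := ncard_union_le _ _
    _ ≤ M.E.ncard.choose q + Tf.card := by
        rw [hS₁]
        gcongr
        rw [← Set.ncard_coe_finset]
        exact ncard_le_ncard hS₂sub Tf.finite_toSet
    _ ≤ _ := by
        have := hTfcard
        omega

end S1

end PercRepro
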